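import Summits.QuantumFields.YangMills.Theorems.BalabanUVNodesN19HybridBeyondTarget

/-!
# BalabanUVNodes ∕ node N19 (NE7) — THE RE-KEYING CALCULUS, PART IV: DESCENT WITH ABSORPTION (the law-merge mechanism in kernel form).
# At a COARSER key an ARBITRARY two-run discrepancy on the summed-out coordinate is absorbed into `Core`'s one constant `c_K` — provided each run
# FACTORISES (class factor × class-independent fibre profile) up to a LIKELIHOOD-RATIO error; the price is that error, not the discrepancy; TV-homogeneity
# does NOT absorb (explicit two-class witness); blockwise LR errors add up (locality ⇒ an extensive LR budget, i.e. a per-unit-volume letter)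

Cell `pub-ymgap` (HUMAN RULING D-0062 Track A ∕ D-0149 width seats), WIDTH SEAT `pub-ymgap-dag-n19-w1` (node n19 = NE7, seat 1 of 3), generation g4,
INTENT-1.  Route `Summits/QuantumFields/YangMills/Theses/BalabanUVNodes.lean`, key item K3⁷ `SpineGivenEndpointR13SepCoPH` (stmt-QuantumFields-20544; v5 stub 2
`stub_expansion13H`, conjunct `KeyedCoreEdgeHolderD4` = N19′ `∃ δ, NE7.Core … ∧ Summable δ`); filed `--kind proof --supports … --as helper`.  COUNT-NEUTRAL.  THEOREMS ONLY
(0 `def`, 0 `sorry`).  ADDITIVE — imports this seat's g3 `…Theorems.BalabanUVNodesN19HybridBeyondTarget` (p602850; through it g3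
`…N19RekeyingAscent` (`sandwich_sum`), g2 `…N19RekeyingCalculus` (`classVal_apply`), the tree's `Spine/NE7/Targets` (`Core`), `T4MatchingAssembly` (`classVal`, `classVal_nonneg`,
`HybridNE7`, `hybridNE7_noShell`), `T4WeightBudget` (`RelWeightBound`)); modifies nothing.

WHY.  Parts I–III of the calculus (p593255 ∕ p601591 ∕ p604222) settled the PRICE LIST of moving N19′'s slot `∃ δ, Core ∧ Summable δ` between class keys: it DESCENDS to any
coarser key for free (`core_classVal`, same constant, same rate), it ASCENDS at the exact price `Fib` (summable intra-fibre homogeneity), and at a coarse key the fibre sums deviate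
by at most the sup ∕ the weighted MEAN of the termwise deviations (`…N19FibreAveragingGain.core_classVal_of_meanDeviation`).  All three price a coarse `Core` BY THE SIZE of the
termwise two-run log-ratio deviation inside a fibre — useless when that deviation is EXTENSIVE, which is the situation the cell has located at the record's pinned key:
first-level saturation (dag-n20-w3 LOCATED-1 (2); dag-n20-w1 `…N20KeyedRelWeightPolicyWall` p597932, `…N20FirstLevelSaturationToy` p605682) puts O(1)-mismatched OLD large-field
structure in essentially every history, the class log-ratio gap is `n_K · D₀` (idea-3 g9 `Cruxes/…/WindowKeyCoreSketch.caricature_not_coreEdge`), and at fixed carriers no dial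
rescues a law-separated pair (CRIT-1 g4 ∕ dag-n19-w4 `…N19NoDialRescuesLawSeparated`).  The surviving design (plan g83 WORDS-4 bookings (1)(7): «re-key the core law at the
WINDOW key», idea-3's card `window-key-core`) needs the OPPOSITE kind of lemma: a descent that ABSORBS an arbitrary old discrepancy into `Core`'s one free constant `c_K` per
level — idea-3's letter (YG) «the log-ratio is additive over pending blocks UP TO A CLASS-INDEPENDENT CONSTANT» presupposes exactly that.  THIS FILE types WHEN the constant
exists ([folklore] finite-sum algebra, nothing of Bałaban's):
* §1 [folklore] `classVal_sandwich_of_factorisation` (a termwise LR-factorisation `x ∈ e^{±s}·(m∘π)·ρ` sums to `classVal x ∈ e^{±s}·m·classVal ρ` on every fibre) · `chain_lower` ∕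
  `chain_upper` (four sandwiches chain).
* §2 [folklore] ★★ `core_classVal_of_factorisation` — DESCENT WITH ABSORPTION, general class map `π`: if run A's fine weights factorise as `p ∈ e^{±s_A(K)}·(m_A∘π)·ρ_A` and run
  B's as `q ∈ e^{±s_B(K)}·(m_B∘π)·ρ_B` (class factors `m` on the COARSE key, fibre profiles `ρ` on the fine key), the CLASS FACTORS satisfy `Core … m_A m_B r` and the re-keyed
  PROFILES satisfy `Core … (classVal ρ_A) (classVal ρ_B) u`, then `Core … (classVal p) (classVal q) (r + u + (s_A + s_B)∕vol)`.  The termwise discrepancy `q∕p` never enters.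
* §3 [folklore] ★★★ `core_fibreSum_of_factorisation` — THE ABSORPTION PROPER on a product key `ι × ω` (class `τ`, summed-out coordinate `o ∈ O K`): profiles `φ_A K o`, `φ_B K o`
  depending on the summed-out coordinate ONLY (class- and source-independent), otherwise ARBITRARY non-negative with positive mass ⇒ the profile `Core` holds with `u = 0` and
  constant `log(Σφ_B ∕ Σφ_A)`, so `Core … (Σ_o p) (Σ_o q) (r + (s_A + s_B)∕vol)`: the old two-run discrepancy `φ_B ∕ φ_A` — unbounded, `K`-dependent, whatever — leaves NO TRACE in
  the radius; it sits in `c_K`.  ★★ `hybridNE7_fibreSum_of_factorisation`: + N20's `RelWeightBound` at the coarse key + summable radius ⇒ `HybridNE7` there, zero shells.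
* §4 [folklore] ★ `prod_sandwich_of_blockwise` · ★★ `factorisation_of_blockwise` — WHERE THE LR ERROR COMES FROM: if run A's weight is a class factor times a PRODUCT over blocks
  `b ∈ B K` of local factors, each class-homogeneous up to `e^{±σ_K}` against a class-independent local profile, then §3's hypothesis holds with `s_A = |B K|·σ_K` — EXTENSIVE; with
  `|B K| ≍ vol` the coarse radius's LR part is the PER-UNIT-VOLUME letter `σ_A(K) + σ_B(K)`, to be summable in `K`.  This is the quantitative form of «old structure decouples from
  the window class»: a per-block LIKELIHOOD-RATIO homogeneity of each run's conditional old-structure law across window classes — NOT smallness of the old activity (saturation is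
  irrelevant here), NOT two-run matching of old structure (absorbed).
* SHARPNESS (companion file `…Theorems.BalabanUVNodesN19RekeyingAbsorptionTVSharp`, same seat, same day): TV-homogeneity of run A's conditional fibre laws does NOT absorb an
  extensive old discrepancy (explicit two-class ∕ two-point toy with exact young matching, a class-independent old factor, TV-close conditional laws at any rate, and NO summable
  `Core` at the class key) — so the homogeneity letter of §3∕§4 must be in LIKELIHOOD-RATIO (max-divergence) form.
READINGS (for the planner ∕ idea-3 ∕ CRIT-1 ∕ the n20 lanes; located, nothing proposed).  (i) The window-key road's one physics letter splits into TWO letters of different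
kind: (Y) young matching of the CLASS FACTORS (`Core … m_A m_B r`, the cut-off-forgetting rate `θ^{K − j⋆(K)}` of the recent window — idea-3's (YG) proper) and (D) per-block
LR-DECOUPLING of each run's old-structure profile from the window class (`σ_A`, `σ_B` summable per unit volume) — a ONE-RUN statement for each run separately, no two-run
content; given (Y)+(D) the old two-run discrepancy is free.  (ii) (D) is where Bałaban's 𝐑-operation ∕ history rewriting would enter: healed old regions re-enter the densities as
local factors whose dependence on the LATER (window) structure is what `σ_K` measures.  (iii) The law-separation letter (LS) of `no_dial_rescues` is the failure of (D) at the
FULL-history key in LR form; the companion file says a TV-form (D) would not rescue it either.  (iv) Neither letter is printed for d = 4; nothing here proves one.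

HONEST FRAMING.  Finite-sum ∕ elementary real-analysis bookkeeping [folklore] over the tree's SHAPES (`Core`, `classVal`, `RelWeightBound`, `HybridNE7`) (the explicit finite toy is the companion file's);
factorisations, profiles, class factors, block structure occur as HYPOTHESES only; nothing of Bałaban's is asserted or instantiated; no estimate of the programme is proved.  NE7 ∕
NE7b NOT PRINTED as two-run statements for d = 4 ([Balaban1987RG1]–[Balaban1989LargeFieldII] bound ONE run; [King1986] (3.10)–(3.13) is the d = 2, 3 template, context only) ∕ NOT
proved; N19 ∕ N20 NOT discharged; K3⁷ OPEN, not claimed; counts UNMOVED (typed 28∕28 · discharged 5∕27, A 5∕28).  Everything below is PROVED (0 `sorry`, 0 named facts, standard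
axioms); no decl carries a cite tag.  One finite four-torus programme at fixed ε — NOT ℝ⁴, NOT infinite volume, NOT OS, NOT a mass gap, NOT the Clay problem (R4 closes the
conditional finite-𝕋⁴ rung `BalabanLadder.UV` only).
-/

noncomputable section

open Finset
open scoped BigOperators

namespace Summit.QuantumFields.YangMills.BalabanUVNodes.N19RekeyingAbsorption

open Summit.QuantumFields.BalabanUV.T4Continuum.Spine.NE7 (Core)
open Literature.MathematicalPhysics.QuantumFieldTheory.Balaban1983to89
open T4WeightBudget (RelWeightBound)
open T4MatchingAssembly (HybridNE7 hybridNE7_noShell classVal classVal_nonneg)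
open Summit.QuantumFields.YangMills.BalabanUVNodes.N19RekeyingCalculus (classVal_apply)
open Summit.QuantumFields.YangMills.BalabanUVNodes.N19RekeyingAscent (sandwich_sum)

variable {σ ι : Type*} [DecidableEq ι]

/-! ## §1 Sandwich arithmetic [folklore] -/

section Arithmetic

/-- **FOUR SANDWICHES CHAIN, LOWER HALF** [folklore].  Run A's fibre sum below `e^{a}·(m_A·R_A)`, run B's above `e^{b}·(m_B·R_B)`, class factors `e^{c}·m_A ≤ m_B`, profiles
`e^{d}·R_A ≤ R_B`, with `m_A, R_B ≥ 0` ⇒ `e^{b + c + d − a}·P ≤ Q`. -/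
theorem chain_lower {P Q mA mB RA RB a b c d : ℝ} (hmA : 0 ≤ mA) (hRB : 0 ≤ RB)
    (h1 : P ≤ Real.exp a * (mA * RA)) (h2 : Real.exp b * (mB * RB) ≤ Q) (h3 : Real.exp c * mA ≤ mB) (h4 : Real.exp d * RA ≤ RB) :
    Real.exp (b + c + d - a) * P ≤ Q := by
  have e1 : Real.exp (-a) * P ≤ mA * RA := by
    have := mul_le_mul_of_nonneg_left h1 (Real.exp_pos (-a)).le
    rwa [← mul_assoc, ← Real.exp_add, neg_add_cancel, Real.exp_zero, one_mul] at this
  have e2 : mA * (Real.exp d * RA) ≤ mA * RB := mul_le_mul_of_nonneg_left h4 hmA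
  have e3 : Real.exp c * mA * RB ≤ mB * RB := mul_le_mul_of_nonneg_right h3 hRB
  have hexp : Real.exp (b + c + d - a) = Real.exp b * (Real.exp c * (Real.exp d * Real.exp (-a))) := by
    simp only [← Real.exp_add]; congr 1; ring
  calc Real.exp (b + c + d - a) * P = Real.exp b * (Real.exp c * (Real.exp d * (Real.exp (-a) * P))) := by rw [hexp]; ring
    _ ≤ Real.exp b * (Real.exp c * (Real.exp d * (mA * RA))) :=
        mul_le_mul_of_nonneg_left (mul_le_mul_of_nonneg_left (mul_le_mul_of_nonneg_left e1 (Real.exp_pos d).le)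
          (Real.exp_pos c).le) (Real.exp_pos b).le
    _ = Real.exp b * (Real.exp c * (mA * (Real.exp d * RA))) := by ring
    _ ≤ Real.exp b * (Real.exp c * (mA * RB)) :=
        mul_le_mul_of_nonneg_left (mul_le_mul_of_nonneg_left e2 (Real.exp_pos c).le) (Real.exp_pos b).le
    _ = Real.exp b * (Real.exp c * mA * RB) := by ring
    _ ≤ Real.exp b * (mB * RB) := mul_le_mul_of_nonneg_left e3 (Real.exp_pos b).le
    _ ≤ Q := h2

/-- **FOUR SANDWICHES CHAIN, UPPER HALF** [folklore].  Run A's fibre sum above `e^{−a}·(m_A·R_A)`, run B's below `e^{b}·(m_B·R_B)`, class factors `m_B ≤ e^{c}·m_A`, profiles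
`R_B ≤ e^{d}·R_A`, with `m_A, R_B ≥ 0` ⇒ `Q ≤ e^{b + c + d + a}·P`. -/
theorem chain_upper {P Q mA mB RA RB a b c d : ℝ} (hmA : 0 ≤ mA) (hRB : 0 ≤ RB)
    (h1 : Real.exp (-a) * (mA * RA) ≤ P) (h2 : Q ≤ Real.exp b * (mB * RB)) (h3 : mB ≤ Real.exp c * mA) (h4 : RB ≤ Real.exp d * RA) :
    Q ≤ Real.exp (b + c + d + a) * P := by
  have e1 : mA * RA ≤ Real.exp a * P := by
    have := mul_le_mul_of_nonneg_left h1 (Real.exp_pos a).le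
    rwa [← mul_assoc, ← Real.exp_add, add_neg_cancel, Real.exp_zero, one_mul] at this
  have e2 : mA * RB ≤ mA * (Real.exp d * RA) := mul_le_mul_of_nonneg_left h4 hmA
  have e3 : mB * RB ≤ Real.exp c * mA * RB := mul_le_mul_of_nonneg_right h3 hRB
  have hexp : Real.exp (b + c + d + a) = Real.exp b * (Real.exp c * (Real.exp d * Real.exp a)) := by
    simp only [← Real.exp_add]; congr 1; ring
  calc Q ≤ Real.exp b * (mB * RB) := h2
    _ ≤ Real.exp b * (Real.exp c * mA * RB) := mul_le_mul_of_nonneg_left e3 (Real.exp_pos b).le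
    _ = Real.exp b * (Real.exp c * (mA * RB)) := by ring
    _ ≤ Real.exp b * (Real.exp c * (mA * (Real.exp d * RA))) :=
        mul_le_mul_of_nonneg_left (mul_le_mul_of_nonneg_left e2 (Real.exp_pos c).le) (Real.exp_pos b).le
    _ = Real.exp b * (Real.exp c * (Real.exp d * (mA * RA))) := by ring
    _ ≤ Real.exp b * (Real.exp c * (Real.exp d * (Real.exp a * P))) :=
        mul_le_mul_of_nonneg_left (mul_le_mul_of_nonneg_left (mul_le_mul_of_nonneg_left e1 (Real.exp_pos d).le)
          (Real.exp_pos c).le) (Real.exp_pos b).le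
    _ = Real.exp (b + c + d + a) * P := by rw [hexp]; ring

variable {S : ℕ → Finset σ} {π : ℕ → σ → ι}

/-- **A TERMWISE LR-FACTORISATION SUMS FIBREWISE** [folklore]: if on the fine index set `x s ∈ e^{±s₀}·m(π s)·ρ s` (class factor `m` read through the class map, fibre profile `ρ`),
then on EVERY fibre the re-keyed family is sandwiched by the class factor times the re-keyed profile: `classVal x τ ∈ e^{±s₀}·m τ·classVal ρ τ`. -/
theorem classVal_sandwich_of_factorisation {K : ℕ} {t : ℝ} {m : ℕ → ℝ → ι → ℝ} {ρ x : ℕ → ℝ → σ → ℝ} {s₀ : ℝ}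
    (hfac : ∀ s ∈ S K, Real.exp (-s₀) * (m K t (π K s) * ρ K t s) ≤ x K t s ∧ x K t s ≤ Real.exp s₀ * (m K t (π K s) * ρ K t s)) (τ : ι) :
    Real.exp (-s₀) * (m K t τ * classVal S π ρ K t τ) ≤ classVal S π x K t τ ∧
      classVal S π x K t τ ≤ Real.exp s₀ * (m K t τ * classVal S π ρ K t τ) := by
  rw [classVal_apply, classVal_apply, Finset.mul_sum]
  exact sandwich_sum fun s hs => by
    obtain ⟨hS, hπ⟩ := Finset.mem_filter.mp hs
    have h := hfac s hS
    rwa [hπ] at h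

end Arithmetic

/-! ## §2 Descent with absorption along a general class map [folklore] -/

section Factorisation
variable {l₀ vol : ℝ} {S : ℕ → Finset σ} {T : ℕ → Finset ι} {π : ℕ → σ → ι}
  {p q ρA ρB : ℕ → ℝ → σ → ℝ} {mA mB : ℕ → ℝ → ι → ℝ} {Bad : ℕ → ℝ → Finset ι} {sA sB r u : ℕ → ℝ}

/-- **★★ DESCENT WITH ABSORPTION** [folklore].  Fine key `σ`, coarse key `ι`, class map `π`.  Suppose
* run A factorises up to a likelihood-ratio error: `p ∈ e^{±s_A(K)}·(m_A∘π)·ρ_A` termwise on `S K` (class factor `m_A` on the coarse key, fibre profile `ρ_A` on the fine key),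
* run B likewise: `q ∈ e^{±s_B(K)}·(m_B∘π)·ρ_B`,
* the CLASS FACTORS match modulo constants at the coarse key: `Core l₀ vol T Bad m_A m_B r`,
* the re-keyed PROFILES match modulo constants there: `Core l₀ vol T Bad (classVal ρ_A) (classVal ρ_B) u`,
with `m_A ≥ 0` on classes, `ρ_B ≥ 0` on terms, `0 < vol`.  Then the re-keyed runs satisfy `Core l₀ vol T Bad (classVal p) (classVal q) (r + u + (s_A + s_B)∕vol)` with constant
`c_K = c_K(m) + c_K(ρ)`.  The termwise two-run discrepancy `q∕p` inside a fibre NEVER ENTERS: only the LR errors and the two coarse matchings are paid.  (Parts I–III price a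
coarse `Core` by the size of the fibrewise deviation; this prices it by homogeneity of the FACTORISATION.) -/
theorem core_classVal_of_factorisation (hvol : 0 < vol)
    (hfacA : ∀ (K : ℕ) (t : ℝ), |t| ≤ l₀ → ∀ s ∈ S K,
      Real.exp (-sA K) * (mA K t (π K s) * ρA K t s) ≤ p K t s ∧ p K t s ≤ Real.exp (sA K) * (mA K t (π K s) * ρA K t s))
    (hfacB : ∀ (K : ℕ) (t : ℝ), |t| ≤ l₀ → ∀ s ∈ S K,
      Real.exp (-sB K) * (mB K t (π K s) * ρB K t s) ≤ q K t s ∧ q K t s ≤ Real.exp (sB K) * (mB K t (π K s) * ρB K t s))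
    (hmA : ∀ (K : ℕ) (t : ℝ), |t| ≤ l₀ → ∀ τ ∈ T K, 0 ≤ mA K t τ)
    (hρB : ∀ (K : ℕ) (t : ℝ), |t| ≤ l₀ → ∀ s ∈ S K, 0 ≤ ρB K t s)
    (hm : Core l₀ vol T Bad mA mB r) (hρ : Core l₀ vol T Bad (classVal S π ρA) (classVal S π ρB) u) :
    Core l₀ vol T Bad (classVal S π p) (classVal S π q) (fun K => r K + u K + (sA K + sB K) / vol) := by
  intro K
  obtain ⟨c₁, hc₁⟩ := hm K
  obtain ⟨c₂, hc₂⟩ := hρ K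
  refine ⟨c₁ + c₂, fun t ht τ hτ => ?_⟩
  have hτT : τ ∈ T K := (Finset.mem_sdiff.mp hτ).1
  obtain ⟨hA₁, hA₂⟩ := classVal_sandwich_of_factorisation (hfacA K t ht) τ
  obtain ⟨hB₁, hB₂⟩ := classVal_sandwich_of_factorisation (hfacB K t ht) τ
  obtain ⟨hm₁, hm₂⟩ := hc₁ t ht τ hτ
  obtain ⟨hρ₁, hρ₂⟩ := hc₂ t ht τ hτ
  have hmA0 : 0 ≤ mA K t τ := hmA K t ht τ hτT
  have hρB0 : 0 ≤ classVal S π ρB K t τ := classVal_nonneg (hρB K t ht) τ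
  have hsum : vol * ((sA K + sB K) / vol) = sA K + sB K := mul_div_cancel₀ _ hvol.ne'
  constructor
  · have h := chain_lower hmA0 hρB0 hA₂ hB₁ hm₁ hρ₁
    have e : c₁ + c₂ - vol * (r K + u K + (sA K + sB K) / vol) = -sB K + (c₁ - vol * r K) + (c₂ - vol * u K) - sA K := by
      rw [mul_add, mul_add, hsum]; ring
    rwa [e]
  · have h := chain_upper hmA0 hρB0 hA₁ hB₂ hm₂ hρ₂
    have e : c₁ + c₂ + vol * (r K + u K + (sA K + sB K) / vol) = sB K + (c₁ + vol * r K) + (c₂ + vol * u K) + sA K := by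
      rw [mul_add, mul_add, hsum]; ring
    rwa [e]

/-- **The exact-profile case** [folklore]: if the re-keyed profiles have an EXACTLY class- and source-independent ratio per level (`classVal ρ_B = e^{C_K}·classVal ρ_A` on the good
classes), the profile `Core` holds at rate `0` and the coarse radius is `r + (s_A + s_B)∕vol`. -/
theorem core_classVal_of_factorisation_exact (hvol : 0 < vol)
    (hfacA : ∀ (K : ℕ) (t : ℝ), |t| ≤ l₀ → ∀ s ∈ S K,
      Real.exp (-sA K) * (mA K t (π K s) * ρA K t s) ≤ p K t s ∧ p K t s ≤ Real.exp (sA K) * (mA K t (π K s) * ρA K t s))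
    (hfacB : ∀ (K : ℕ) (t : ℝ), |t| ≤ l₀ → ∀ s ∈ S K,
      Real.exp (-sB K) * (mB K t (π K s) * ρB K t s) ≤ q K t s ∧ q K t s ≤ Real.exp (sB K) * (mB K t (π K s) * ρB K t s))
    (hmA : ∀ (K : ℕ) (t : ℝ), |t| ≤ l₀ → ∀ τ ∈ T K, 0 ≤ mA K t τ)
    (hρB : ∀ (K : ℕ) (t : ℝ), |t| ≤ l₀ → ∀ s ∈ S K, 0 ≤ ρB K t s)
    (hm : Core l₀ vol T Bad mA mB r)
    (hρ : ∀ K : ℕ, ∃ C : ℝ, ∀ t : ℝ, |t| ≤ l₀ → ∀ τ ∈ T K \ Bad K t, classVal S π ρB K t τ = Real.exp C * classVal S π ρA K t τ) :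
    Core l₀ vol T Bad (classVal S π p) (classVal S π q) (fun K => r K + (sA K + sB K) / vol) := by
  have hρ' : Core l₀ vol T Bad (classVal S π ρA) (classVal S π ρB) (fun _ => 0) := fun K => by
    obtain ⟨C, hC⟩ := hρ K
    exact ⟨C, fun t ht τ hτ => by rw [mul_zero, sub_zero, add_zero, hC t ht τ hτ]; exact ⟨le_rfl, le_rfl⟩⟩
  have h := core_classVal_of_factorisation hvol hfacA hfacB hmA hρB hm hρ'
  simpa only [add_zero] using h

end Factorisation

/-! ## §3 The absorption proper: a product key, profiles on the summed-out coordinate only [folklore] -/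

section Product
variable {ω : Type*} {l₀ vol : ℝ} {T : ℕ → Finset ι} {O : ℕ → Finset ω} {Bad : ℕ → ℝ → Finset ι}
  {p q : ℕ → ℝ → ι × ω → ℝ} {mA mB : ℕ → ℝ → ι → ℝ} {φA φB : ℕ → ω → ℝ} {sA sB r W : ℕ → ℝ}

/-- On the product key `ι × ω` with class map `Prod.fst`, the re-keyed family over `T K ×ˢ O K` at a class `τ ∈ T K` is the plain sum over the summed-out coordinate. [folklore] -/
theorem classVal_fst_prod (f : ℕ → ℝ → ι × ω → ℝ) {K : ℕ} (t : ℝ) {τ : ι} (hτ : τ ∈ T K) :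
    classVal (fun K => T K ×ˢ O K) (fun _ => Prod.fst) f K t τ = ∑ o ∈ O K, f K t (τ, o) := by
  rw [classVal_apply]
  have hset : (T K ×ˢ O K).filter (fun x : ι × ω => x.1 = τ) = ({τ} : Finset ι) ×ˢ O K := by
    ext ⟨a, o⟩
    simp only [Finset.mem_filter, Finset.mem_product, Finset.mem_singleton]
    constructor
    · rintro ⟨⟨-, ho⟩, rfl⟩
      exact ⟨rfl, ho⟩
    · rintro ⟨rfl, ho⟩
      exact ⟨⟨hτ, ho⟩, rfl⟩
  rw [hset, Finset.sum_product, Finset.sum_singleton]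

/-- **★★★ THE ABSORPTION** [folklore].  Product key: classes `τ ∈ T K`, summed-out coordinate `o ∈ O K` (e.g. τ = the recent-window structure, o = the old structure).  Suppose
each run factorises up to an LR error into a class factor and a profile of the summed-out coordinate ALONE,
`p K t (τ,o) ∈ e^{±s_A(K)}·m_A K t τ·φ_A K o`, `q K t (τ,o) ∈ e^{±s_B(K)}·m_B K t τ·φ_B K o`, with `m_A ≥ 0`, `φ_B ≥ 0`, `Σ_{O K} φ_A > 0`, `Σ_{O K} φ_B > 0`, and the class factors
match modulo constants, `Core l₀ vol T Bad m_A m_B r`.  Then the fibre sums match modulo constants at radius `r + (s_A + s_B)∕vol`: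
`Core l₀ vol T Bad (Σ_o p) (Σ_o q) (r + (s_A+s_B)∕vol)`.  THE POINT: the profiles — the two runs' weights on the summed-out coordinate — enter only through EXISTENCE; their ratio
`φ_B∕φ_A` (the old two-run discrepancy) may be unbounded, `K`-dependent, anything, and leaves no trace in the radius: it is absorbed into the constant
`c_K = c_K(m) + log(Σφ_B K ∕ Σφ_A K)`. -/
theorem core_fibreSum_of_factorisation (hvol : 0 < vol)
    (hfacA : ∀ (K : ℕ) (t : ℝ), |t| ≤ l₀ → ∀ τ ∈ T K, ∀ o ∈ O K,
      Real.exp (-sA K) * (mA K t τ * φA K o) ≤ p K t (τ, o) ∧ p K t (τ, o) ≤ Real.exp (sA K) * (mA K t τ * φA K o))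
    (hfacB : ∀ (K : ℕ) (t : ℝ), |t| ≤ l₀ → ∀ τ ∈ T K, ∀ o ∈ O K,
      Real.exp (-sB K) * (mB K t τ * φB K o) ≤ q K t (τ, o) ∧ q K t (τ, o) ≤ Real.exp (sB K) * (mB K t τ * φB K o))
    (hmA : ∀ (K : ℕ) (t : ℝ), |t| ≤ l₀ → ∀ τ ∈ T K, 0 ≤ mA K t τ) (hφB : ∀ K, ∀ o ∈ O K, 0 ≤ φB K o)
    (hφApos : ∀ K, 0 < ∑ o ∈ O K, φA K o) (hφBpos : ∀ K, 0 < ∑ o ∈ O K, φB K o)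
    (hm : Core l₀ vol T Bad mA mB r) :
    Core l₀ vol T Bad (fun K t τ => ∑ o ∈ O K, p K t (τ, o)) (fun K t τ => ∑ o ∈ O K, q K t (τ, o)) (fun K => r K + (sA K + sB K) / vol) := by
  intro K
  obtain ⟨c₁, hc₁⟩ := hm K
  -- the absorbed constant: the log-ratio of the profiles' masses
  set C : ℝ := Real.log ((∑ o ∈ O K, φB K o) / ∑ o ∈ O K, φA K o) with hC
  have hCexp : Real.exp C * ∑ o ∈ O K, φA K o = ∑ o ∈ O K, φB K o := by
    rw [hC, Real.exp_log (div_pos (hφBpos K) (hφApos K)), div_mul_cancel₀ _ (hφApos K).ne']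
  refine ⟨c₁ + C, fun t ht τ hτ => ?_⟩
  have hτT : τ ∈ T K := (Finset.mem_sdiff.mp hτ).1
  -- fibre sums of the factorisations
  have hA := sandwich_sum (F := O K) (p := fun o => mA K t τ * φA K o) (q := fun o => p K t (τ, o)) fun o ho => hfacA K t ht τ hτT o ho
  have hB := sandwich_sum (F := O K) (p := fun o => mB K t τ * φB K o) (q := fun o => q K t (τ, o)) fun o ho => hfacB K t ht τ hτT o ho
  rw [← Finset.mul_sum] at hA hB
  obtain ⟨hm₁, hm₂⟩ := hc₁ t ht τ hτ
  have hmA0 : 0 ≤ mA K t τ := hmA K t ht τ hτT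
  have hRB0 : 0 ≤ ∑ o ∈ O K, φB K o := Finset.sum_nonneg (hφB K)
  have hsum : vol * ((sA K + sB K) / vol) = sA K + sB K := mul_div_cancel₀ _ hvol.ne'
  constructor
  · have h := chain_lower hmA0 hRB0 hA.2 hB.1 hm₁ hCexp.le
    have e : c₁ + C - vol * (r K + (sA K + sB K) / vol) = -sB K + (c₁ - vol * r K) + C - sA K := by
      rw [mul_add, hsum]; ring
    rwa [e]
  · have h := chain_upper hmA0 hRB0 hA.1 hB.2 hm₂ hCexp.ge
    have e : c₁ + C + vol * (r K + (sA K + sB K) / vol) = sB K + (c₁ + vol * r K) + C + sA K := by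
      rw [mul_add, hsum]; ring
    rwa [e]

/-- The same conclusion in the calculus's `classVal` language (class map `Prod.fst` over `T K ×ˢ O K`), for consumers of Parts I–III. [folklore] -/
theorem core_classVal_fst_of_factorisation (hvol : 0 < vol)
    (hfacA : ∀ (K : ℕ) (t : ℝ), |t| ≤ l₀ → ∀ τ ∈ T K, ∀ o ∈ O K,
      Real.exp (-sA K) * (mA K t τ * φA K o) ≤ p K t (τ, o) ∧ p K t (τ, o) ≤ Real.exp (sA K) * (mA K t τ * φA K o))
    (hfacB : ∀ (K : ℕ) (t : ℝ), |t| ≤ l₀ → ∀ τ ∈ T K, ∀ o ∈ O K,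
      Real.exp (-sB K) * (mB K t τ * φB K o) ≤ q K t (τ, o) ∧ q K t (τ, o) ≤ Real.exp (sB K) * (mB K t τ * φB K o))
    (hmA : ∀ (K : ℕ) (t : ℝ), |t| ≤ l₀ → ∀ τ ∈ T K, 0 ≤ mA K t τ) (hφB : ∀ K, ∀ o ∈ O K, 0 ≤ φB K o)
    (hφApos : ∀ K, 0 < ∑ o ∈ O K, φA K o) (hφBpos : ∀ K, 0 < ∑ o ∈ O K, φB K o) (hm : Core l₀ vol T Bad mA mB r) :
    Core l₀ vol T Bad (classVal (fun K => T K ×ˢ O K) (fun _ => Prod.fst) p) (classVal (fun K => T K ×ˢ O K) (fun _ => Prod.fst) q)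
      (fun K => r K + (sA K + sB K) / vol) := by
  intro K
  obtain ⟨c, hc⟩ := core_fibreSum_of_factorisation hvol hfacA hfacB hmA hφB hφApos hφBpos hm K
  refine ⟨c, fun t ht τ hτ => ?_⟩
  have hτT : τ ∈ T K := (Finset.mem_sdiff.mp hτ).1
  rw [classVal_fst_prod p t hτT, classVal_fst_prod q t hτT]
  exact hc t ht τ hτ

/-- **★★ THE BINDER LIST AT THE COARSE KEY** [folklore]: §3's `Core` + N20's `RelWeightBound` for the fibre sums at the coarse key (a hypothesis — e.g. `Bad := ∅`, `W := 0` when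
nothing is cut) + non-negative terms + a summable radius ⇒ `HybridNE7` at the coarse key with zero shells (`T4MatchingAssembly.hybridNE7_noShell` BY NAME). -/
theorem hybridNE7_fibreSum_of_factorisation (hvol : 0 < vol)
    (hfacA : ∀ (K : ℕ) (t : ℝ), |t| ≤ l₀ → ∀ τ ∈ T K, ∀ o ∈ O K,
      Real.exp (-sA K) * (mA K t τ * φA K o) ≤ p K t (τ, o) ∧ p K t (τ, o) ≤ Real.exp (sA K) * (mA K t τ * φA K o))
    (hfacB : ∀ (K : ℕ) (t : ℝ), |t| ≤ l₀ → ∀ τ ∈ T K, ∀ o ∈ O K,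
      Real.exp (-sB K) * (mB K t τ * φB K o) ≤ q K t (τ, o) ∧ q K t (τ, o) ≤ Real.exp (sB K) * (mB K t τ * φB K o))
    (hmA : ∀ (K : ℕ) (t : ℝ), |t| ≤ l₀ → ∀ τ ∈ T K, 0 ≤ mA K t τ) (hφB : ∀ K, ∀ o ∈ O K, 0 ≤ φB K o)
    (hφApos : ∀ K, 0 < ∑ o ∈ O K, φA K o) (hφBpos : ∀ K, 0 < ∑ o ∈ O K, φB K o)
    (hm : Core l₀ vol T Bad mA mB r)
    (hp : ∀ (K : ℕ) (t : ℝ), |t| ≤ l₀ → ∀ τ ∈ T K, ∀ o ∈ O K, 0 ≤ p K t (τ, o))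
    (hq : ∀ (K : ℕ) (t : ℝ), |t| ≤ l₀ → ∀ τ ∈ T K, ∀ o ∈ O K, 0 ≤ q K t (τ, o))
    (hW : RelWeightBound l₀ T (fun K t τ => ∑ o ∈ O K, p K t (τ, o)) (fun K t τ => ∑ o ∈ O K, q K t (τ, o)) Bad W)
    (hrad : Summable fun K => r K + (sA K + sB K) / vol) :
    HybridNE7 l₀ vol T (fun K t τ => ∑ o ∈ O K, p K t (τ, o)) (fun K t τ => ∑ o ∈ O K, q K t (τ, o)) Bad W
      (fun _ _ _ => 0) (fun _ _ _ => 0) (fun _ => 0) (fun K => r K + (sA K + sB K) / vol) :=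
  hybridNE7_noShell hW (fun K t ht τ hτ => Finset.sum_nonneg fun o ho => hp K t ht τ hτ o ho)
    (fun K t ht τ hτ => Finset.sum_nonneg fun o ho => hq K t ht τ hτ o ho) hrad
    (core_fibreSum_of_factorisation hvol hfacA hfacB hmA hφB hφApos hφBpos hm)

end Product

/-! ## §4 Where the LR error comes from: blockwise homogeneity adds up (locality ⇒ an extensive LR budget) [folklore] -/

section Blocks
variable {β ω : Type*}

/-- **★ BLOCKWISE SANDWICHES MULTIPLY** [folklore]: if every block factor is class-homogeneous up to `e^{±s₀}` against a non-negative reference factor, `φ b ∈ e^{±s₀}·ψ b` for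
`b ∈ B`, then the products are sandwiched with the EXTENSIVE modulus `|B|·s₀`: `∏ φ ∈ e^{±|B|·s₀}·∏ ψ`. -/
theorem prod_sandwich_of_blockwise {B : Finset β} {φ ψ : β → ℝ} {s₀ : ℝ} (hψ : ∀ b ∈ B, 0 ≤ ψ b)
    (h : ∀ b ∈ B, Real.exp (-s₀) * ψ b ≤ φ b ∧ φ b ≤ Real.exp s₀ * ψ b) :
    Real.exp (-(B.card * s₀)) * ∏ b ∈ B, ψ b ≤ ∏ b ∈ B, φ b ∧ ∏ b ∈ B, φ b ≤ Real.exp (B.card * s₀) * ∏ b ∈ B, ψ b := by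
  have hφ : ∀ b ∈ B, 0 ≤ φ b := fun b hb => (mul_nonneg (Real.exp_pos _).le (hψ b hb)).trans (h b hb).1
  constructor
  · calc Real.exp (-(B.card * s₀)) * ∏ b ∈ B, ψ b = ∏ b ∈ B, Real.exp (-s₀) * ψ b := by
          rw [Finset.prod_mul_distrib, Finset.prod_const, ← Real.exp_nat_mul, mul_neg]
      _ ≤ ∏ b ∈ B, φ b := Finset.prod_le_prod (fun b hb => mul_nonneg (Real.exp_pos _).le (hψ b hb)) fun b hb => (h b hb).1
  · calc ∏ b ∈ B, φ b ≤ ∏ b ∈ B, Real.exp s₀ * ψ b := Finset.prod_le_prod hφ fun b hb => (h b hb).2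
      _ = Real.exp (B.card * s₀) * ∏ b ∈ B, ψ b := by
          rw [Finset.prod_mul_distrib, Finset.prod_const, ← Real.exp_nat_mul]

variable {l₀ : ℝ} {T : ℕ → Finset ι} {O : ℕ → Finset ω} {B : ℕ → Finset β}
  {m : ℕ → ℝ → ι → ℝ} {φ : ℕ → ℝ → β → ι → ω → ℝ} {ψ : ℕ → β → ω → ℝ} {s₀ : ℕ → ℝ}

omit [DecidableEq ι] in
/-- **★★ §3's FACTORISATION HYPOTHESIS FROM BLOCKWISE LR-HOMOGENEITY** [folklore].  If a run's weight is a class factor times a PRODUCT over blocks `b ∈ B K` of local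
factors `φ K t b τ o`, each homogeneous across classes up to `e^{±σ_K}` against a class- and source-independent local profile `ψ K b o ≥ 0` of the summed-out coordinate, then
the run factorises as §3 asks with profile `∏_b ψ K b o` and LR error `s = |B K|·σ_K`.  With `|B K| ≍ vol` blocks the LR part of §3's radius `(s_A + s_B)∕vol` is the
PER-UNIT-VOLUME letter `σ_A(K) + σ_B(K)` — the quantity a window-key proof of N19′ must show summable in `K`: per-block likelihood-ratio decoupling of each run's old-structure
factors from the window class.  One run at a time; no two-run content. -/
theorem factorisation_of_blockwise (hm : ∀ (K : ℕ) (t : ℝ), |t| ≤ l₀ → ∀ τ ∈ T K, 0 ≤ m K t τ)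
    (hψ : ∀ K, ∀ b ∈ B K, ∀ o ∈ O K, 0 ≤ ψ K b o)
    (h : ∀ (K : ℕ) (t : ℝ), |t| ≤ l₀ → ∀ τ ∈ T K, ∀ o ∈ O K, ∀ b ∈ B K,
      Real.exp (-s₀ K) * ψ K b o ≤ φ K t b τ o ∧ φ K t b τ o ≤ Real.exp (s₀ K) * ψ K b o) :
    ∀ (K : ℕ) (t : ℝ), |t| ≤ l₀ → ∀ τ ∈ T K, ∀ o ∈ O K,
      Real.exp (-((B K).card * s₀ K)) * (m K t τ * ∏ b ∈ B K, ψ K b o) ≤ m K t τ * ∏ b ∈ B K, φ K t b τ o ∧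
        m K t τ * ∏ b ∈ B K, φ K t b τ o ≤ Real.exp ((B K).card * s₀ K) * (m K t τ * ∏ b ∈ B K, ψ K b o) := by
  intro K t ht τ hτ o ho
  obtain ⟨hlo, hhi⟩ := prod_sandwich_of_blockwise (fun b hb => hψ K b hb o ho) fun b hb => h K t ht τ hτ o ho b hb
  have hm0 := hm K t ht τ hτ
  constructor
  · calc Real.exp (-((B K).card * s₀ K)) * (m K t τ * ∏ b ∈ B K, ψ K b o)
        = m K t τ * (Real.exp (-((B K).card * s₀ K)) * ∏ b ∈ B K, ψ K b o) := by ring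
      _ ≤ m K t τ * ∏ b ∈ B K, φ K t b τ o := mul_le_mul_of_nonneg_left hlo hm0
  · calc m K t τ * ∏ b ∈ B K, φ K t b τ o ≤ m K t τ * (Real.exp ((B K).card * s₀ K) * ∏ b ∈ B K, ψ K b o) := mul_le_mul_of_nonneg_left hhi hm0
      _ = Real.exp ((B K).card * s₀ K) * (m K t τ * ∏ b ∈ B K, ψ K b o) := by ring

end Blocks

end Summit.QuantumFields.YangMills.BalabanUVNodes.N19RekeyingAbsorption
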